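import Literature.Topology.FourManifolds.GompfTwistedStraightening
import Literature.Topology.FourManifolds.GompfFramedSpheresProofs
import HarnessLib

/-!
# F, F₀ and Theorem 4.3 from fishtail twisting data on the straightened product models

Top-level assembly for the framed form of R. Gompf, *More Cappell–Shaneson spheres are standard*,
Algebr. Geom. Topol. 10 (2010), Theorem 2.1: the named facts
`Literature.Topology.FourManifolds.gompf2010_framedTwist` (F),
`Literature.Topology.FourManifolds.gompf2010_framedTwistZero` (F₀) and Gompf's Theorem 4.3
(`Literature.Topology.FourManifolds.gompf2010_thm43`) follow as soon as, for every `B` in standard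
form with `det (B - 1) = 1` and every framing path `γ` of `B`, **some** straightening `S` of `B` in
the class of `γ` carries a diffeomorphism of its straightened product model minus the fibre sliver,
`S.prodSphere ∖ Σ`, twisting across the sliver by Gompf's far Dehn twist — the output of the
fishtail neighbourhood and Lemma 2.2 of Gompf's proof (hypotheses of
`nonempty_diffeomorph_prodSurgered_of_twistingDiffeo`, `GompfProductTwist.lean`). The chain is
`Straightening.nonempty_diffeomorph_gompfSphere_deltaLeft_one_of_prodTwistingDiffeo`
(`GompfTwistedStraightening.lean`: the `k = 1` framed row move for the class of `S`) →
`gompf2010_framedTwist_of_one` (`GompfFramedSpheresProofs.lean`) →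
`gompf2010_framedTwistZero_of_framedTwist`, `gompf2010_thm43_of_framedTwist`
(`GompfFramedTwistZero.lean`).

* `Literature.Topology.FourManifolds.gompf2010_framedTwist_of_prodTwistingDiffeo`,
  `Literature.Topology.FourManifolds.gompf2010_framedTwistZero_of_prodTwistingDiffeo`,
  `Literature.Topology.FourManifolds.gompf2010_thm43_of_prodTwistingDiffeo`;
* the same at an **arbitrary tube radius** `0 < ε ≤ π - τ` on which the monodromy is the identity
  (the radius at which twisting data transferred from a model arrive; the radius of a product tube
  is immaterial, `nonempty_diffeomorph_prodSurgered_radius`):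
  `Literature.Topology.FourManifolds.Straightening.nonempty_diffeomorph_gompfSphere_deltaLeft_one_of_prodTwistingDiffeo_radius`,
  `Literature.Topology.FourManifolds.Straightening.nonempty_diffeomorph_gompfSphere_deltaLeft_one_of_prodTwistingDiffeo_of_eq`,
  `Literature.Topology.FourManifolds.gompf2010_framedTwist_of_prodTwistingDiffeo_radius`,
  `Literature.Topology.FourManifolds.gompf2010_framedTwistZero_of_prodTwistingDiffeo_radius`,
  `Literature.Topology.FourManifolds.gompf2010_thm43_of_prodTwistingDiffeo_radius`.

Everything here is proved; no named facts are introduced.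

## References

* R. E. Gompf, *More Cappell–Shaneson spheres are standard*, Algebr. Geom. Topol. 10 (2010)
  1665–1681: Thm 2.1 (proof, last paragraph), Lemma 2.2, §4 ¶3–¶5, Thm 4.3. [GompfAGT2010]
-/

open scoped Manifold ContDiff Topology Real
open Set Function Metric

noncomputable section

namespace Literature.Topology.FourManifolds


/-- **F from fishtail twisting data on the straightened product models.** Suppose that for every
`B ∈ SL(3, ℤ)` in standard form with `det (B - 1) = 1` and every framing path `γ` of `B` there are
a straightening `S` of `B` with exactly linear germs in the class of `γ`, a parameter
`0 < τ < π/2` for Gompf's far Dehn twist `δ = farDehn hτ hτ'`, an open neighbourhood `V` of the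
fibre sliver `farSupport τ × {1}` in the second cylinder missing the fibre through `1` and stable
under the sliver twist of `δ⁻¹`, and a diffeomorphism `G` of `S.prodSphere ∖ Σ` twisting across
the sliver by `δ` on `V` (Gompf's fishtail neighbourhood and Lemma 2.2). Then the framed form F of
Theorem 2.1 holds (`gompf2010_framedTwist_of_one` applied to the row moves
`Straightening.nonempty_diffeomorph_gompfSphere_deltaLeft_one_of_prodTwistingDiffeo`). [cite: GompfAGT2010, Thm 2.1 (proof, last paragraph) and §4 ¶3] -/
theorem gompf2010_framedTwist_of_prodTwistingDiffeo
    (h : ∀ (B : Matrix.SpecialLinearGroup (Fin 3) ℤ), IsGompfStandardForm B →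
      ((B : Matrix (Fin 3) (Fin 3) ℤ) - 1).det = 1 → ∀ (γ : SmoothMatrixPath (slRealMatrix B)),
      ∃ (S : Straightening B) (τ : ℝ) (hτ : 0 < τ) (hτ' : τ < π / 2)
        (V : TopologicalSpace.Opens (ThreeTorus × ↥mappingTorusPieceTwo))
        (hV1 : ∀ b ∈ V, b.1 ≠ 1)
        (G : ↥((prodTube S.monodromy S.prodRad S.prodRad_pos S.prodRad_le_pi
            S.monodromy_expT_of_norm_lt).localOpens (prodSliverCompl S.monodromy (isClosed_farSupport τ))) ≃ₘ⟮𝓡 4, 𝓡 4⟯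
          ↥((prodTube S.monodromy S.prodRad S.prodRad_pos S.prodRad_le_pi
            S.monodromy_expT_of_norm_lt).localOpens (prodSliverCompl S.monodromy (isClosed_farSupport τ)))),
        γ.toPath.Homotopic S.path.toPath ∧ fibreSliver (farSupport τ) ⊆ V ∧
          (∀ b ∈ V, sliverTwist (farDehn hτ hτ').symm b ∈ V) ∧
          ∀ (x : ↥((prodTube S.monodromy S.prodRad S.prodRad_pos S.prodRad_le_pi
              S.monodromy_expT_of_norm_lt).localOpens (prodSliverCompl S.monodromy (isClosed_farSupport τ))))
            (b : ↥V), (b : ThreeTorus × ↥mappingTorusPieceTwo) ∉ fibreSliver (farSupport τ) →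
              (x : S.prodSphere) = (prodTube S.monodromy S.prodRad S.prodRad_pos S.prodRad_le_pi
                S.monodromy_expT_of_norm_lt).glueData.inl
                (opensToComplement (prodTube S.monodromy S.prodRad S.prodRad_pos S.prodRad_le_pi
                  S.monodromy_expT_of_norm_lt) (mtGlueData S.monodromy).inr V
                  (inr_not_mem_range_secCircle_self S.monodromy S.prodRad_pos S.prodRad_le_pi
                    S.monodromy_expT_of_norm_lt V hV1) b) →
                ∃ a' : ↥(prodTube S.monodromy S.prodRad S.prodRad_pos S.prodRad_le_pi
                    S.monodromy_expT_of_norm_lt).complement,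
                  (a' : MTorus S.monodromy) = (mtGlueData S.monodromy).inr (sliverTwist (farDehn hτ hτ') b) ∧
                    (G x : S.prodSphere) = (prodTube S.monodromy S.prodRad S.prodRad_pos S.prodRad_le_pi
                      S.monodromy_expT_of_norm_lt).glueData.inl a') :
    gompf2010_framedTwist :=
  gompf2010_framedTwist_of_one fun B hB hdet β ↦ by
    obtain ⟨S, τ, hτ, hτ', V, hV1, G, hγ, hVS, hVg, hG⟩ := h B hB hdet β
    exact S.nonempty_diffeomorph_gompfSphere_deltaLeft_one_of_prodTwistingDiffeo hτ hτ' β hγ V hVS hV1 hVg G hG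

/-- **F₀ from fishtail twisting data** (`gompf2010_framedTwistZero_of_framedTwist`: the `Δ₀`-moves
are the `Δ`-moves after the change of basis of §4 ¶5). [cite: GompfAGT2010, §4 ¶5 (X^{τ·σ}_B = X^σ_A for B = Δ₀ᵏ A or A Δ₀ᵏ)] -/
theorem gompf2010_framedTwistZero_of_prodTwistingDiffeo
    (h : ∀ (B : Matrix.SpecialLinearGroup (Fin 3) ℤ), IsGompfStandardForm B →
      ((B : Matrix (Fin 3) (Fin 3) ℤ) - 1).det = 1 → ∀ (γ : SmoothMatrixPath (slRealMatrix B)),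
      ∃ (S : Straightening B) (τ : ℝ) (hτ : 0 < τ) (hτ' : τ < π / 2)
        (V : TopologicalSpace.Opens (ThreeTorus × ↥mappingTorusPieceTwo))
        (hV1 : ∀ b ∈ V, b.1 ≠ 1)
        (G : ↥((prodTube S.monodromy S.prodRad S.prodRad_pos S.prodRad_le_pi
            S.monodromy_expT_of_norm_lt).localOpens (prodSliverCompl S.monodromy (isClosed_farSupport τ))) ≃ₘ⟮𝓡 4, 𝓡 4⟯
          ↥((prodTube S.monodromy S.prodRad S.prodRad_pos S.prodRad_le_pi
            S.monodromy_expT_of_norm_lt).localOpens (prodSliverCompl S.monodromy (isClosed_farSupport τ)))),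
        γ.toPath.Homotopic S.path.toPath ∧ fibreSliver (farSupport τ) ⊆ V ∧
          (∀ b ∈ V, sliverTwist (farDehn hτ hτ').symm b ∈ V) ∧
          ∀ (x : ↥((prodTube S.monodromy S.prodRad S.prodRad_pos S.prodRad_le_pi
              S.monodromy_expT_of_norm_lt).localOpens (prodSliverCompl S.monodromy (isClosed_farSupport τ))))
            (b : ↥V), (b : ThreeTorus × ↥mappingTorusPieceTwo) ∉ fibreSliver (farSupport τ) →
              (x : S.prodSphere) = (prodTube S.monodromy S.prodRad S.prodRad_pos S.prodRad_le_pi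
                S.monodromy_expT_of_norm_lt).glueData.inl
                (opensToComplement (prodTube S.monodromy S.prodRad S.prodRad_pos S.prodRad_le_pi
                  S.monodromy_expT_of_norm_lt) (mtGlueData S.monodromy).inr V
                  (inr_not_mem_range_secCircle_self S.monodromy S.prodRad_pos S.prodRad_le_pi
                    S.monodromy_expT_of_norm_lt V hV1) b) →
                ∃ a' : ↥(prodTube S.monodromy S.prodRad S.prodRad_pos S.prodRad_le_pi
                    S.monodromy_expT_of_norm_lt).complement,
                  (a' : MTorus S.monodromy) = (mtGlueData S.monodromy).inr (sliverTwist (farDehn hτ hτ') b) ∧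
                    (G x : S.prodSphere) = (prodTube S.monodromy S.prodRad S.prodRad_pos S.prodRad_le_pi
                      S.monodromy_expT_of_norm_lt).glueData.inl a') :
    gompf2010_framedTwistZero :=
  gompf2010_framedTwistZero_of_framedTwist (gompf2010_framedTwist_of_prodTwistingDiffeo h)

/-- **Gompf's Theorem 4.3 from fishtail twisting data** (`gompf2010_thm43_of_framedTwist`). [cite: GompfAGT2010, Thm 4.3] -/
theorem gompf2010_thm43_of_prodTwistingDiffeo
    (h : ∀ (B : Matrix.SpecialLinearGroup (Fin 3) ℤ), IsGompfStandardForm B →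
      ((B : Matrix (Fin 3) (Fin 3) ℤ) - 1).det = 1 → ∀ (γ : SmoothMatrixPath (slRealMatrix B)),
      ∃ (S : Straightening B) (τ : ℝ) (hτ : 0 < τ) (hτ' : τ < π / 2)
        (V : TopologicalSpace.Opens (ThreeTorus × ↥mappingTorusPieceTwo))
        (hV1 : ∀ b ∈ V, b.1 ≠ 1)
        (G : ↥((prodTube S.monodromy S.prodRad S.prodRad_pos S.prodRad_le_pi
            S.monodromy_expT_of_norm_lt).localOpens (prodSliverCompl S.monodromy (isClosed_farSupport τ))) ≃ₘ⟮𝓡 4, 𝓡 4⟯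
          ↥((prodTube S.monodromy S.prodRad S.prodRad_pos S.prodRad_le_pi
            S.monodromy_expT_of_norm_lt).localOpens (prodSliverCompl S.monodromy (isClosed_farSupport τ)))),
        γ.toPath.Homotopic S.path.toPath ∧ fibreSliver (farSupport τ) ⊆ V ∧
          (∀ b ∈ V, sliverTwist (farDehn hτ hτ').symm b ∈ V) ∧
          ∀ (x : ↥((prodTube S.monodromy S.prodRad S.prodRad_pos S.prodRad_le_pi
              S.monodromy_expT_of_norm_lt).localOpens (prodSliverCompl S.monodromy (isClosed_farSupport τ))))
            (b : ↥V), (b : ThreeTorus × ↥mappingTorusPieceTwo) ∉ fibreSliver (farSupport τ) →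
              (x : S.prodSphere) = (prodTube S.monodromy S.prodRad S.prodRad_pos S.prodRad_le_pi
                S.monodromy_expT_of_norm_lt).glueData.inl
                (opensToComplement (prodTube S.monodromy S.prodRad S.prodRad_pos S.prodRad_le_pi
                  S.monodromy_expT_of_norm_lt) (mtGlueData S.monodromy).inr V
                  (inr_not_mem_range_secCircle_self S.monodromy S.prodRad_pos S.prodRad_le_pi
                    S.monodromy_expT_of_norm_lt V hV1) b) →
                ∃ a' : ↥(prodTube S.monodromy S.prodRad S.prodRad_pos S.prodRad_le_pi
                    S.monodromy_expT_of_norm_lt).complement,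
                  (a' : MTorus S.monodromy) = (mtGlueData S.monodromy).inr (sliverTwist (farDehn hτ hτ') b) ∧
                    (G x : S.prodSphere) = (prodTube S.monodromy S.prodRad S.prodRad_pos S.prodRad_le_pi
                      S.monodromy_expT_of_norm_lt).glueData.inl a') :
    gompf2010_thm43 :=
  gompf2010_thm43_of_framedTwist (gompf2010_framedTwist_of_prodTwistingDiffeo h)

/-! ### Twisting data at an arbitrary tube radius

The transfer principle for twisting data (`GompfTwistLocality.lean`) moves Gompf's fishtail
diffeomorphism from one straightened model to every straightened monodromy agreeing with it on a
tube around `α`, **at the tube radius `ε` of the model**, whereas the socket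
`Straightening.nonempty_diffeomorph_gompfSphere_deltaLeft_one_of_prodTwistingDiffeo`
(`GompfTwistedStraightening.lean`) asks for twisting data on `S.prodSphere`, whose radius
`S.prodRad` depends on the matrix and on the straightening. The radius of the product tube is
immaterial (`nonempty_diffeomorph_prodSurgered_radius`: the surgeries along product tubes of two
admissible radii are diffeomorphic), so we record the socket and the top-level assembly for
twisting data at *any* admissible radius `0 < ε ≤ π - τ` on which the monodromy is the identity. -/

namespace Straightening

variable {B : Matrix.SpecialLinearGroup (Fin 3) ℤ} (S : Straightening B) {τ : ℝ} (hτ : 0 < τ)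
  (hτ' : τ < π / 2)

/-- **The framed `k = 1` row move from twisting data at any tube radius.** Let `S` be a
straightening of `B` with exactly linear germs, `δ = farDehn hτ hτ'` Gompf's far Dehn twist,
`0 < ε ≤ π - τ` a radius with `S.monodromy = id` on `expT (B(0, ε))` (so that the product tube of
radius `ε` misses the support of `δ`), `V` an open neighbourhood of the fibre sliver
`farSupport τ × {1}` in the second cylinder missing the fibre through `1` and stable under the
sliver twist of `δ⁻¹`, and `G` a diffeomorphism of `prodSurgered S.monodromy ε ∖ Σ` twisting
across the sliver by `δ` on `V` (Gompf's fishtail neighbourhood and Lemma 2.2). Then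
`gompfSphere B γ ≃ₘ gompfSphere (Δ B) (γ.deltaLeft 1)` for every framing path `γ` in the class of
`S`. Chain: `gompfSphere B γ ≅ S.prodSphere` (transport) `≅ prodSurgered S.monodromy ε` (change of
radius) `≅ prodSurgered (δ ∘ S.monodromy) ε` (twist criterion
`nonempty_diffeomorph_prodSurgered_of_twistingDiffeo`) `≅ gompfSphere (Δ B) (γ.deltaLeft 1)`
(`nonempty_diffeomorph_prodSurgered_trans_farDehn`, valid at every radius). [cite: GompfAGT2010, Thm 2.1 (proof, last paragraph) and §4 ¶3 (X^{τ·σ}_B = X^σ_A)] -/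
theorem nonempty_diffeomorph_gompfSphere_deltaLeft_one_of_prodTwistingDiffeo_radius
    (γ : SmoothMatrixPath (slRealMatrix B)) (hγ : γ.toPath.Homotopic S.path.toPath)
    {ε : ℝ} (hε : 0 < ε) (hεπ : ε ≤ π) (hετ : ε ≤ π - τ)
    (hψ : ∀ v : EuclideanSpace ℝ (Fin 3), ‖v‖ < ε → S.monodromy (expT v) = expT v)
    (V : TopologicalSpace.Opens (ThreeTorus × ↥mappingTorusPieceTwo))
    (hVS : fibreSliver (farSupport τ) ⊆ V) (hV1 : ∀ b ∈ V, b.1 ≠ 1)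
    (hVg : ∀ b ∈ V, sliverTwist (farDehn hτ hτ').symm b ∈ V)
    (G : ↥((prodTube S.monodromy ε hε hεπ hψ).localOpens
        (prodSliverCompl S.monodromy (isClosed_farSupport τ))) ≃ₘ⟮𝓡 4, 𝓡 4⟯
      ↥((prodTube S.monodromy ε hε hεπ hψ).localOpens
        (prodSliverCompl S.monodromy (isClosed_farSupport τ))))
    (hG : ∀ (x : ↥((prodTube S.monodromy ε hε hεπ hψ).localOpens
        (prodSliverCompl S.monodromy (isClosed_farSupport τ))))
      (b : ↥V), (b : ThreeTorus × ↥mappingTorusPieceTwo) ∉ fibreSliver (farSupport τ) →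
        (x : prodSurgered S.monodromy ε hε hεπ hψ) = (prodTube S.monodromy ε hε hεπ hψ).glueData.inl
          (opensToComplement (prodTube S.monodromy ε hε hεπ hψ) (mtGlueData S.monodromy).inr V
            (inr_not_mem_range_secCircle_self S.monodromy hε hεπ hψ V hV1) b) →
          ∃ a' : ↥(prodTube S.monodromy ε hε hεπ hψ).complement,
            (a' : MTorus S.monodromy) = (mtGlueData S.monodromy).inr (sliverTwist (farDehn hτ hτ') b) ∧
              (G x : prodSurgered S.monodromy ε hε hεπ hψ) =
                (prodTube S.monodromy ε hε hεπ hψ).glueData.inl a') :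
    Nonempty (gompfSphere B γ ≃ₘ⟮𝓡 4, 𝓡 4⟯ gompfSphere (gompfDelta ^ (1 : ℤ) * B) (γ.deltaLeft 1)) := by
  have hgS : ∀ y ∉ farSupport τ, farDehn hτ hτ' y = y := fun y hy ↦ farDehn_eq_self hτ hτ' hy
  have hSε : ∀ v : EuclideanSpace ℝ (Fin 3), ‖v‖ < ε → expT v ∉ farSupport τ := fun v hv ↦
    expT_not_mem_farSupport hτ (by
      have h1 : |v 1| ≤ ‖v‖ := (Real.norm_eq_abs _).symm.le.trans (PiLp.norm_apply_le v 1)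
      linarith)
  have e1 := S.nonempty_diffeomorph_gompfSphere_prodSphere_of_homotopic γ hγ
  have e1' := nonempty_diffeomorph_prodSurgered_radius S.monodromy S.prodRad_pos S.prodRad_le_pi
    S.monodromy_expT_of_norm_lt hε hεπ hψ
  have e2 := nonempty_diffeomorph_prodSurgered_of_twistingDiffeo S.monodromy hε hεπ hψ
    (farDehn hτ hτ') (isClosed_farSupport τ) hgS hSε V hVS hV1 hVg G hG
  have e3 := S.nonempty_diffeomorph_prodSurgered_trans_farDehn hτ hτ' hε hεπ
    (trans_apply_expT_of_norm_lt S.monodromy hψ (farDehn hτ hτ') hgS hSε) γ hγ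
  exact nonempty_diffeomorph_trans e1
    (nonempty_diffeomorph_trans e1' (nonempty_diffeomorph_trans e2 e3))

/-- **The framed `k = 1` row move from twisting data for a monodromy equal to `S.monodromy`, at
any tube radius** — the form in which transferred twisting data arrive when the target monodromy
`ψ` is only propositionally the monodromy of the straightening `S` (`h : S.monodromy = ψ`). [cite: GompfAGT2010, Thm 2.1 (proof, last paragraph) and §4 ¶3 (X^{τ·σ}_B = X^σ_A)] -/
theorem nonempty_diffeomorph_gompfSphere_deltaLeft_one_of_prodTwistingDiffeo_of_eq
    (ψ : ThreeTorus ≃ₘ⟮ModelWithCorners.prod (𝓡 1) (ModelWithCorners.prod (𝓡 1) (𝓡 1)),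
      ModelWithCorners.prod (𝓡 1) (ModelWithCorners.prod (𝓡 1) (𝓡 1))⟯ ThreeTorus) (h : S.monodromy = ψ)
    (γ : SmoothMatrixPath (slRealMatrix B)) (hγ : γ.toPath.Homotopic S.path.toPath)
    {ε : ℝ} (hε : 0 < ε) (hεπ : ε ≤ π) (hετ : ε ≤ π - τ)
    (hψ : ∀ v : EuclideanSpace ℝ (Fin 3), ‖v‖ < ε → ψ (expT v) = expT v)
    (V : TopologicalSpace.Opens (ThreeTorus × ↥mappingTorusPieceTwo))
    (hVS : fibreSliver (farSupport τ) ⊆ V) (hV1 : ∀ b ∈ V, b.1 ≠ 1)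
    (hVg : ∀ b ∈ V, sliverTwist (farDehn hτ hτ').symm b ∈ V)
    (G : ↥((prodTube ψ ε hε hεπ hψ).localOpens (prodSliverCompl ψ (isClosed_farSupport τ))) ≃ₘ⟮𝓡 4, 𝓡 4⟯
      ↥((prodTube ψ ε hε hεπ hψ).localOpens (prodSliverCompl ψ (isClosed_farSupport τ))))
    (hG : ∀ (x : ↥((prodTube ψ ε hε hεπ hψ).localOpens (prodSliverCompl ψ (isClosed_farSupport τ))))
      (b : ↥V), (b : ThreeTorus × ↥mappingTorusPieceTwo) ∉ fibreSliver (farSupport τ) →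
        (x : prodSurgered ψ ε hε hεπ hψ) = (prodTube ψ ε hε hεπ hψ).glueData.inl
          (opensToComplement (prodTube ψ ε hε hεπ hψ) (mtGlueData ψ).inr V
            (inr_not_mem_range_secCircle_self ψ hε hεπ hψ V hV1) b) →
          ∃ a' : ↥(prodTube ψ ε hε hεπ hψ).complement,
            (a' : MTorus ψ) = (mtGlueData ψ).inr (sliverTwist (farDehn hτ hτ') b) ∧
              (G x : prodSurgered ψ ε hε hεπ hψ) = (prodTube ψ ε hε hεπ hψ).glueData.inl a') :
    Nonempty (gompfSphere B γ ≃ₘ⟮𝓡 4, 𝓡 4⟯ gompfSphere (gompfDelta ^ (1 : ℤ) * B) (γ.deltaLeft 1)) := by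
  subst h
  exact S.nonempty_diffeomorph_gompfSphere_deltaLeft_one_of_prodTwistingDiffeo_radius hτ hτ' γ hγ hε
    hεπ hετ hψ V hVS hV1 hVg G hG

end Straightening

/-- **F from fishtail twisting data at any tube radius.** As
`gompf2010_framedTwist_of_prodTwistingDiffeo`, but the twisting diffeomorphism may live on the
product-framed surgery `prodSurgered S.monodromy ε` of *any* admissible radius `0 < ε ≤ π - τ` on
which the straightened monodromy is the identity (the radius at which the transfer of Gompf's
fishtail diffeomorphism from a model delivers it), rather than on `S.prodSphere`. [cite: GompfAGT2010, Thm 2.1 (proof, last paragraph) and §4 ¶3] -/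
theorem gompf2010_framedTwist_of_prodTwistingDiffeo_radius
    (h : ∀ (B : Matrix.SpecialLinearGroup (Fin 3) ℤ), IsGompfStandardForm B →
      ((B : Matrix (Fin 3) (Fin 3) ℤ) - 1).det = 1 → ∀ (γ : SmoothMatrixPath (slRealMatrix B)),
      ∃ (S : Straightening B) (τ : ℝ) (hτ : 0 < τ) (hτ' : τ < π / 2) (ε : ℝ) (hε : 0 < ε)
        (hεπ : ε ≤ π) (_ : ε ≤ π - τ)
        (hψ : ∀ v : EuclideanSpace ℝ (Fin 3), ‖v‖ < ε → S.monodromy (expT v) = expT v)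
        (V : TopologicalSpace.Opens (ThreeTorus × ↥mappingTorusPieceTwo))
        (hV1 : ∀ b ∈ V, b.1 ≠ 1)
        (G : ↥((prodTube S.monodromy ε hε hεπ hψ).localOpens
            (prodSliverCompl S.monodromy (isClosed_farSupport τ))) ≃ₘ⟮𝓡 4, 𝓡 4⟯
          ↥((prodTube S.monodromy ε hε hεπ hψ).localOpens
            (prodSliverCompl S.monodromy (isClosed_farSupport τ)))),
        γ.toPath.Homotopic S.path.toPath ∧ fibreSliver (farSupport τ) ⊆ V ∧
          (∀ b ∈ V, sliverTwist (farDehn hτ hτ').symm b ∈ V) ∧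
          ∀ (x : ↥((prodTube S.monodromy ε hε hεπ hψ).localOpens
              (prodSliverCompl S.monodromy (isClosed_farSupport τ))))
            (b : ↥V), (b : ThreeTorus × ↥mappingTorusPieceTwo) ∉ fibreSliver (farSupport τ) →
              (x : prodSurgered S.monodromy ε hε hεπ hψ) = (prodTube S.monodromy ε hε hεπ hψ).glueData.inl
                (opensToComplement (prodTube S.monodromy ε hε hεπ hψ) (mtGlueData S.monodromy).inr V
                  (inr_not_mem_range_secCircle_self S.monodromy hε hεπ hψ V hV1) b) →
                ∃ a' : ↥(prodTube S.monodromy ε hε hεπ hψ).complement,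
                  (a' : MTorus S.monodromy) = (mtGlueData S.monodromy).inr (sliverTwist (farDehn hτ hτ') b) ∧
                    (G x : prodSurgered S.monodromy ε hε hεπ hψ) =
                      (prodTube S.monodromy ε hε hεπ hψ).glueData.inl a') :
    gompf2010_framedTwist :=
  gompf2010_framedTwist_of_one fun B hB hdet β ↦ by
    obtain ⟨S, τ, hτ, hτ', ε, hε, hεπ, hετ, hψ, V, hV1, G, hγ, hVS, hVg, hG⟩ := h B hB hdet β
    exact S.nonempty_diffeomorph_gompfSphere_deltaLeft_one_of_prodTwistingDiffeo_radius hτ hτ' β hγ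
      hε hεπ hετ hψ V hVS hV1 hVg G hG

/-- **F₀ from fishtail twisting data at any tube radius**
(`gompf2010_framedTwistZero_of_framedTwist`). [cite: GompfAGT2010, §4 ¶5 (X^{τ·σ}_B = X^σ_A for B = Δ₀ᵏ A or A Δ₀ᵏ)] -/
theorem gompf2010_framedTwistZero_of_prodTwistingDiffeo_radius
    (h : ∀ (B : Matrix.SpecialLinearGroup (Fin 3) ℤ), IsGompfStandardForm B →
      ((B : Matrix (Fin 3) (Fin 3) ℤ) - 1).det = 1 → ∀ (γ : SmoothMatrixPath (slRealMatrix B)),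
      ∃ (S : Straightening B) (τ : ℝ) (hτ : 0 < τ) (hτ' : τ < π / 2) (ε : ℝ) (hε : 0 < ε)
        (hεπ : ε ≤ π) (_ : ε ≤ π - τ)
        (hψ : ∀ v : EuclideanSpace ℝ (Fin 3), ‖v‖ < ε → S.monodromy (expT v) = expT v)
        (V : TopologicalSpace.Opens (ThreeTorus × ↥mappingTorusPieceTwo))
        (hV1 : ∀ b ∈ V, b.1 ≠ 1)
        (G : ↥((prodTube S.monodromy ε hε hεπ hψ).localOpens
            (prodSliverCompl S.monodromy (isClosed_farSupport τ))) ≃ₘ⟮𝓡 4, 𝓡 4⟯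
          ↥((prodTube S.monodromy ε hε hεπ hψ).localOpens
            (prodSliverCompl S.monodromy (isClosed_farSupport τ)))),
        γ.toPath.Homotopic S.path.toPath ∧ fibreSliver (farSupport τ) ⊆ V ∧
          (∀ b ∈ V, sliverTwist (farDehn hτ hτ').symm b ∈ V) ∧
          ∀ (x : ↥((prodTube S.monodromy ε hε hεπ hψ).localOpens
              (prodSliverCompl S.monodromy (isClosed_farSupport τ))))
            (b : ↥V), (b : ThreeTorus × ↥mappingTorusPieceTwo) ∉ fibreSliver (farSupport τ) →
              (x : prodSurgered S.monodromy ε hε hεπ hψ) = (prodTube S.monodromy ε hε hεπ hψ).glueData.inl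
                (opensToComplement (prodTube S.monodromy ε hε hεπ hψ) (mtGlueData S.monodromy).inr V
                  (inr_not_mem_range_secCircle_self S.monodromy hε hεπ hψ V hV1) b) →
                ∃ a' : ↥(prodTube S.monodromy ε hε hεπ hψ).complement,
                  (a' : MTorus S.monodromy) = (mtGlueData S.monodromy).inr (sliverTwist (farDehn hτ hτ') b) ∧
                    (G x : prodSurgered S.monodromy ε hε hεπ hψ) =
                      (prodTube S.monodromy ε hε hεπ hψ).glueData.inl a') :
    gompf2010_framedTwistZero :=
  gompf2010_framedTwistZero_of_framedTwist (gompf2010_framedTwist_of_prodTwistingDiffeo_radius h)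

/-- **Gompf's Theorem 4.3 from fishtail twisting data at any tube radius**
(`gompf2010_thm43_of_framedTwist`). [cite: GompfAGT2010, Thm 4.3] -/
theorem gompf2010_thm43_of_prodTwistingDiffeo_radius
    (h : ∀ (B : Matrix.SpecialLinearGroup (Fin 3) ℤ), IsGompfStandardForm B →
      ((B : Matrix (Fin 3) (Fin 3) ℤ) - 1).det = 1 → ∀ (γ : SmoothMatrixPath (slRealMatrix B)),
      ∃ (S : Straightening B) (τ : ℝ) (hτ : 0 < τ) (hτ' : τ < π / 2) (ε : ℝ) (hε : 0 < ε)
        (hεπ : ε ≤ π) (_ : ε ≤ π - τ)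
        (hψ : ∀ v : EuclideanSpace ℝ (Fin 3), ‖v‖ < ε → S.monodromy (expT v) = expT v)
        (V : TopologicalSpace.Opens (ThreeTorus × ↥mappingTorusPieceTwo))
        (hV1 : ∀ b ∈ V, b.1 ≠ 1)
        (G : ↥((prodTube S.monodromy ε hε hεπ hψ).localOpens
            (prodSliverCompl S.monodromy (isClosed_farSupport τ))) ≃ₘ⟮𝓡 4, 𝓡 4⟯
          ↥((prodTube S.monodromy ε hε hεπ hψ).localOpens
            (prodSliverCompl S.monodromy (isClosed_farSupport τ)))),
        γ.toPath.Homotopic S.path.toPath ∧ fibreSliver (farSupport τ) ⊆ V ∧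
          (∀ b ∈ V, sliverTwist (farDehn hτ hτ').symm b ∈ V) ∧
          ∀ (x : ↥((prodTube S.monodromy ε hε hεπ hψ).localOpens
              (prodSliverCompl S.monodromy (isClosed_farSupport τ))))
            (b : ↥V), (b : ThreeTorus × ↥mappingTorusPieceTwo) ∉ fibreSliver (farSupport τ) →
              (x : prodSurgered S.monodromy ε hε hεπ hψ) = (prodTube S.monodromy ε hε hεπ hψ).glueData.inl
                (opensToComplement (prodTube S.monodromy ε hε hεπ hψ) (mtGlueData S.monodromy).inr V
                  (inr_not_mem_range_secCircle_self S.monodromy hε hεπ hψ V hV1) b) →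
                ∃ a' : ↥(prodTube S.monodromy ε hε hεπ hψ).complement,
                  (a' : MTorus S.monodromy) = (mtGlueData S.monodromy).inr (sliverTwist (farDehn hτ hτ') b) ∧
                    (G x : prodSurgered S.monodromy ε hε hεπ hψ) =
                      (prodTube S.monodromy ε hε hεπ hψ).glueData.inl a') :
    gompf2010_thm43 :=
  gompf2010_thm43_of_framedTwist (gompf2010_framedTwist_of_prodTwistingDiffeo_radius h)

end Literature.Topology.FourManifolds
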